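import Summits.ABC.ABC.Theses.IsogenyGlueCongruence
import Summits.ABC.ABC.Theorems.IsogenyGlueCongruenceSharpDegreeOfPolyHeightPosition
import Summits.ABC.ABC.Theorems.SharpDegreeOfPolyHeight.Negative.HypothesisFloor
import Summits.ABC.ABC.Theorems.SharpDegreeOfPolyDegree.Negative.ExponentFloor
import Summits.ABC.ABC.Theorems.PolyHeightOfBoundedPrimes.Negative.FalseWithoutMinimality
import Literature.NumberTheory.EllipticCurves.HeightCovolumeBoundsProofs
import Literature.Barriers.ABC.SzpiroEpsilonCannotBeDroppedHolds

set_option linter.dupNamespace false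

/-!
# Disproof of `SharpDegreeOfPolyHeight` (crux R′, stmt-ABC-16009) — findings of the cdisprove seat, v1.1

`R′ := SharpDegreeOfPolyHeight = (H → X)` (definitionally, `crux_iff`), where
* `H` (`PolyHeight` below, verbatim the antecedent) = the POLYNOMIAL HEIGHT CONJECTURE for semistable
  curves: `∃ σ C, max(|Δ_W|, |c₄(W)|³) ≤ C · N_W^σ` for every semistable elliptic `W/ℚ` in global
  minimal form (`N_W = W.conductorNorm ℤ`); Szpiro's conjecture in its original undetermined-exponent
  form, `c₄`-gauge, semistable case;
* `X = SemistableDegreeConjecture` (the route's target stmt-ABC-2044): `∀ ε > 0 ∃ C`, every such `W`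
  has a `ModularParametrizationData W N_W` of degree `≤ C · N_W^{2+ε}`.
`R′` is the route-choice re-cut (05c66fb8) of `R = SharpDegreeOfPolyDegree` (stmt-ABC-10895,
`P → X`); `R′ → R` unconditionally, `R → R′` modulo the Manin/modularity items (p117414).

READ-BACK (W.lean rc 0; `Iff.rfl` against the verbatim signature): `σ, C : ℝ` existential OUTSIDE the
`∀ W` (uniform constants, as printed); `N_W ^ σ` is `Real.rpow` of a cast natural `≥ 1`
(`conductorNorm_pos_holds`, so `[NeZero]` is redundant but harmless, `neZero_redundant`); the height
gauge is `((max |W.Δ| (|W.c₄|^3) : ℚ) : ℝ)` of the MODEL, pinned to the minimal discriminant / minimal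
`c₄` by `[W.IsGloballyMinimal]`; `D.modularDegree : ℕ` is pinned to the true degree by `deg_spec`
(generic fibre count of the actual map `X₀(N) → E(ℂ)`), `D.c ∈ ℤ` by `smul_periodLattice_le`, and
Zagier's `4π² c² (f,f) = deg · covol` is a tree THEOREM — no junk inhabitant of the datum type can
undercut the degree (deg ≥ 4π²(f,f)/covol for every datum). No `/`, ℕ-subtraction, `tsum`, `sSup`.

## VERDICT (cycle 1): NO KILL — the obstruction is a theorem of the tree
`not_crux_iff : ¬ R′ ↔ H ∧ ¬ X` (landed p117414).  A disproof must (a) PROVE polynomial Szpiro for all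
semistable curves — open, and ⟺ polynomial abc on normalised triples via Frey curves — and (b) REFUTE
`X`, which modulo three known-in-print inputs refutes the summit (`not_abc_of_not_crux_of_facts`:
`¬ R′ → ¬ ABC` mod {optimal datum, Česnavičius `|c| = 1`, Mazur–Kenku}).  Conversely `ABC → H`
(Bombieri–Gubler 12.5.12, PROVED in tree) closes the vacuous road (`of_not_polyHeight`): `R′` fails
exactly in the world "polynomial Szpiro yes, abc no", on which nothing in print or in the tree bears.
Modulo {PeterssonLowerBound, optimal datum, `|c| = 1`, MazurKenkuBound} `R′ ↔ (H ↔ ABC)` (landed), i.e.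
`R′` ≡ "undetermined-exponent Szpiro ⟹ (6+ε)-Szpiro" ≡ "weak abc ⟹ strong abc": a pure
EXPONENT-LOWERING statement; every amplification paradigm checked by the two ideate rounds contracts
(BarrierNotes-r1-k2 N1–N7, sibling BarrierNotes r1-k1/k3).  No finite computation bears on an
implication between two `∃C`-asymptotic statements (kit not used: nothing to certify).

## What IS proved here / landed (all sorry-free unless marked NEAR-MISS)
§1 position (refs to p117414).  §2 LOAD-BEARING ANALYSIS: the crux has ONE hypothesis, `H`;
`R′` without `H` is `X` itself (`cruxWithoutH_iff`), whose negation refutes the summit mod facts — so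
"any proof must use `H`" cannot be certified by a counterexample; what can be certified is which
BINDERS of `H` matter: `[IsGloballyMinimal]` inside `H` is load-bearing for `H`'s truth
(`not_polyHeightNonMinimal`, landed by B′'s seat; rescaled Frey curve `3 + 32 = 35`) so moving it out
makes `R′` VACUOUSLY true (`cruxWithNonMinimalH_trivial`) — planners: keep it; `IsSemistable` inside
`H` is not load-bearing for plausibility (`H` for all curves follows from BG-Szpiro, landed).  GAUGE
MUTATION (paper remark, no Lean): replacing `max(|Δ|, |c₄|³)` in `H` by `|Δ|` alone (plain polynomial
Szpiro `H_Δ`) gives `H → H_Δ` trivially, so `(H_Δ → X) → R′`, but `H_Δ → H` would need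
`|c₄|³ ≪ N^{σ'}` from `|Δ| ≪ N^σ`, i.e. a POLYNOMIAL HALL-type bound for `c₄³ − c₆² = 1728 Δ`
(open; Baker gives only `exp`, barrier `BakerMethodBounds`; Danilov's `|x³ − y²| ≍ √x` families sit at
`|c₄|³ ≍ N⁶`, consistent with `σ > 6`): the `Δ`-only re-statement is a silently STRONGER item, and the
`c₄`-gauge of `R′` is the right (Faltings-height) one.
§3 DEGENERATE PARAMETERS: every slice `σ ≤ 6` of `H` is false (Masser; landed p117587), and — NEW,
LANDED `Negative/StrengthenedConsequent.lean` (p120014) — even the polylog slice `C · N⁶ (log N)^k` is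
false (`not_polyHeightPolylog`); any witness has `σ > 6`, `C > 0`.
§4 CONSEQUENT FLOOR (natural strengthenings refuted): exponent `θ < 3/2` unconditionally, `θ < 2` mod
`PeterssonLowerBound` (sibling p80513, re-read on `R′` in p120014: strengthened crux `↔ ¬H → ¬ABC`);
NEW, LANDED `Negative/ConsequentFloor.lean` (p120081): THE `ε` OF `X` CANNOT BE DROPPED, not even up to
`(log N)^A`, and the `∃ C ∀ ε` quantifier swap is false — modulo ONE Goldfeld–Hoffstein–Lieman-type input
(`DegCovolInput`: `deg · covol ≥ c N/(log N)^a`, implied by `(f,f) ≥ c N/(log N)^a` via Zagier, or by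
the vendored named fact `watkins2004_thm_5_1`); ingredients otherwise PROVED (Watkins L2.1
`covol · |Δ|^{1/6} ≤ 14.045`, Masser polylog excess).  The sibling Disproof (v3, §5) had recorded this
endpoint as out of reach.  Barrier-candidate: `DegreeEpsilonCannotBeDropped`.
§5 NO FORMAL AMPLIFICATION (`not_shape_amplification_height`).  §6 NEAR-MISSES (sorried, with
obstruction): the unconditional `ε = 0` floor (needs GHL in the tree).  §7 TARGETS: none this cycle
(payload.targets = [], the picked "line" `Sketch` is the ideator's census with no `stub_*`; lead -0
ended `blocked-on: stmt-ABC-2044`).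

How to use (provers / planners): do not aim below exponent `2` nor at `ε = 0` in the consequent, do not
fix `σ ≤ 6` or a polylog form in the hypothesis, keep `[IsGloballyMinimal]` inside `H`; the item closes
as `PolyHeightOfBoundedPrimes.sharpDegreeOfPolyHeight_of_semistableDegreeConjecture hX` the day
stmt-ABC-2044 lands and is otherwise exactly as hard as `X` (given `H`), i.e. as abc.
-/

noncomputable section

namespace Summit.ABC.ABC.Cruxes.SharpDegreeOfPolyHeight.Disproof

open Summit.ABC.ABC.Theses.IsogenyGlueCongruence
open Summit.ABC.ABC.Theorems.SharpDegreeOfPolyDegree.Negative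
  (exists_globallyMinimal_model exists_semistable_globallyMinimal
    not_targetWithExponent_of_lt_three_halves not_targetWithExponent_of_lt_two)
open Summit.ABC.ABC.Theorems.SharpDegreeOfPolyHeight.Negative
  (not_polyHeightAt_of_le_six six_lt_of_polyHeightAt pos_of_polyHeightAt)
open Literature.NumberTheory.EllipticCurves Literature.NumberTheory.EllipticCurves.ModularForms
open Literature.NumberTheory.Automorphic (exists_optimal_modularParametrizationData)
open WeierstrassCurve CongruenceSubgroup Filter Topology

/-! ## §0 Vocabulary (definitions allowed in a crux workfile) and read-back -/

/-- `H`: the antecedent of the crux, verbatim. -/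
def PolyHeight : Prop :=
  ∃ σ C : ℝ, ∀ (W : WeierstrassCurve ℚ) [W.IsElliptic] [W.IsGloballyMinimal]
    [NeZero (W.conductorNorm ℤ)], W.IsSemistable ℤ →
      ((max |W.Δ| (|W.c₄| ^ 3) : ℚ) : ℝ) ≤ C * (W.conductorNorm ℤ : ℝ) ^ σ

/-- The `σ`-slice of `H` (constant still free). -/
def PolyHeightAt (σ : ℝ) : Prop :=
  ∃ C : ℝ, ∀ (W : WeierstrassCurve ℚ) [W.IsElliptic] [W.IsGloballyMinimal]
    [NeZero (W.conductorNorm ℤ)], W.IsSemistable ℤ →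
      ((max |W.Δ| (|W.c₄| ^ 3) : ℚ) : ℝ) ≤ C * (W.conductorNorm ℤ : ℝ) ^ σ

/-- The polylog slice of `H` at the critical exponent `6`. -/
def PolyHeightPolylog : Prop :=
  ∃ C k : ℝ, ∀ (W : WeierstrassCurve ℚ) [W.IsElliptic] [W.IsGloballyMinimal]
    [NeZero (W.conductorNorm ℤ)], W.IsSemistable ℤ →
      ((max |W.Δ| (|W.c₄| ^ 3) : ℚ) : ℝ) ≤
        C * (W.conductorNorm ℤ : ℝ) ^ 6 * Real.log (W.conductorNorm ℤ) ^ k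

/-- `H` with the binder `[W.IsGloballyMinimal]` dropped (mutation). -/
def PolyHeightNonMinimal : Prop :=
  ∃ σ C : ℝ, ∀ (W : WeierstrassCurve ℚ) [W.IsElliptic] [NeZero (W.conductorNorm ℤ)],
    W.IsSemistable ℤ → ((max |W.Δ| (|W.c₄| ^ 3) : ℚ) : ℝ) ≤ C * (W.conductorNorm ℤ : ℝ) ^ σ

/-- Degree bound with exponent `θ` (the `∃D`-form of the route). -/
def DegreeBoundAt (θ : ℝ) : Prop :=
  ∃ C : ℝ, ∀ (W : WeierstrassCurve ℚ) [W.IsElliptic] [W.IsGloballyMinimal]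
    [NeZero (W.conductorNorm ℤ)], W.IsSemistable ℤ →
      ∃ D : ModularParametrizationData W (W.conductorNorm ℤ),
        (D.modularDegree : ℝ) ≤ C * (W.conductorNorm ℤ : ℝ) ^ θ

/-- The modular-degree conjecture with exponent `θ` in place of `2`. -/
def TargetWithExponent (θ : ℝ) : Prop := ∀ ε : ℝ, 0 < ε → DegreeBoundAt (θ + ε)

/-- The `ε = 0` endpoint of `X` with a polylog allowance `(log N)^A`. -/
def DegreeBoundTwoPolylog (A : ℝ) : Prop :=
  ∃ C : ℝ, ∀ (W : WeierstrassCurve ℚ) [W.IsElliptic] [W.IsGloballyMinimal]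
    [NeZero (W.conductorNorm ℤ)], W.IsSemistable ℤ →
      ∃ D : ModularParametrizationData W (W.conductorNorm ℤ),
        (D.modularDegree : ℝ) ≤ C * (W.conductorNorm ℤ : ℝ) ^ 2 * Real.log (W.conductorNorm ℤ) ^ A

/-- The ONE analytic input of §4 (Goldfeld–Hoffstein–Lieman type): `deg · covol(Λ_W) ≥ c N/(log N)^a`
for the data of semistable globally minimal curves with `N ≥ N₀`. Implied by `(f,f) ≥ c' N/(log N)^a`
(`degCovolInput_of_peterssonLog`) and by the named fact `watkins2004_thm_5_1`
(`degCovolInput_of_watkins`). -/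
def DegCovolInput : Prop :=
  ∃ a c : ℝ, 0 < c ∧ ∃ N₀ : ℕ, ∀ (W : WeierstrassCurve ℚ) [W.IsElliptic]
    [W.IsGloballyMinimal] [NeZero (W.conductorNorm ℤ)], W.IsSemistable ℤ →
      N₀ ≤ W.conductorNorm ℤ → ∀ D : ModularParametrizationData W (W.conductorNorm ℤ),
        c * (W.conductorNorm ℤ : ℝ) / Real.log (W.conductorNorm ℤ) ^ a ≤
          (D.modularDegree : ℝ) * ZLattice.covolume D.L.lattice

/-- The crux with the exponent `2` of its consequent replaced by `θ`. -/
def CruxWithExponent (θ : ℝ) : Prop := PolyHeight → TargetWithExponent θ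

/-- The crux with the `ε` of its consequent dropped. -/
def CruxEpsZero : Prop := PolyHeight → DegreeBoundAt 2

/-- The crux with its one hypothesis `H` dropped: the target itself. -/
def CruxWithoutH : Prop := SemistableDegreeConjecture

/-- The crux with `[IsGloballyMinimal]` moved out of `H` (mutation of a binder of the hypothesis). -/
def CruxWithNonMinimalH : Prop := PolyHeightNonMinimal → SemistableDegreeConjecture

theorem polyHeight_iff : PolyHeight ↔ ∃ σ : ℝ, PolyHeightAt σ :=
  ⟨fun ⟨σ, C, h⟩ => ⟨σ, C, h⟩, fun ⟨σ, C, h⟩ => ⟨σ, C, h⟩⟩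

theorem target_iff : SemistableDegreeConjecture ↔ TargetWithExponent 2 := Iff.rfl

/-- The crux decl IS `H → X` (read-back by `Iff.rfl`). -/
theorem crux_iff : SharpDegreeOfPolyHeight ↔ (PolyHeight → SemistableDegreeConjecture) := Iff.rfl

theorem crux_iff' : SharpDegreeOfPolyHeight ↔ CruxWithExponent 2 := Iff.rfl

/-- `[NeZero (W.conductorNorm ℤ)]` is redundant: the conductor of an elliptic curve over `ℚ` is a
positive integer (`conductorNorm_pos_holds`). [folklore] -/
theorem neZero_redundant (W : WeierstrassCurve ℚ) [W.IsElliptic] : NeZero (W.conductorNorm ℤ) :=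
  ⟨(conductorNorm_pos_holds W).ne'⟩

/-! ## §1 Logical position (landed, p117414 — cited, not re-proved) -/

/-- `¬ R′ ↔ H ∧ ¬ X`. -/
theorem not_crux_iff : ¬ SharpDegreeOfPolyHeight ↔ PolyHeight ∧ ¬ SemistableDegreeConjecture :=
  Summit.ABC.ABC.Theorems.SharpDegreeOfPolyHeight.not_iff

/-- `X → R′` (the closing move the day stmt-ABC-2044 lands). -/
theorem of_target (hX : SemistableDegreeConjecture) : SharpDegreeOfPolyHeight := fun _ => hX

/-- `¬ H → R′` (vacuous road) — closed unless the summit is false: `ABC → H`. -/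
theorem of_not_polyHeight (h : ¬ PolyHeight) : SharpDegreeOfPolyHeight := fun hH => absurd hH h

theorem polyHeight_of_abc (h : ABC) : PolyHeight :=
  Summit.ABC.ABC.Theorems.SharpDegreeOfPolyHeight.polyHeight_of_abc h

/-- **A disproof of `R′` disproves the summit** modulo three known-in-print inputs (optimal datum on a
global minimal model, `|c| = 1` for semistable optimal curves, Mazur–Kenku). [cite: MurtyCongruencePrimes1999, Thm. 1 (ii)] -/
theorem not_abc_of_not_crux_of_facts (hOpt : exists_optimal_modularParametrizationData)
    (hc1 : ∀ {N : ℕ} [NeZero N] {W₀ : WeierstrassCurve ℚ} (D₀ : ModularParametrizationData W₀ N),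
      D₀.abs_maninConstant_eq_one_of_isSemistable)
    (hMK : MazurKenkuBound) (h : ¬ SharpDegreeOfPolyHeight) : ¬ ABC := fun habc =>
  h (Summit.ABC.ABC.Theorems.SharpDegreeOfPolyHeight.of_abc_of_facts hOpt hc1 hMK habc)

/-! ## §2 Load-bearing analysis -/

/-- `R′` without its hypothesis is the target. -/
theorem cruxWithoutH_iff : CruxWithoutH ↔ SemistableDegreeConjecture := Iff.rfl

/-- "`R′` is false without `H`" would be `¬ X`, which refutes the summit modulo the three inputs —
so the load-bearing role of `H` cannot be certified by a counterexample inside the tree. [cite: MurtyCongruencePrimes1999, Thm. 1 (ii)] -/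
theorem not_abc_of_not_cruxWithoutH_of_facts (hOpt : exists_optimal_modularParametrizationData)
    (hc1 : ∀ {N : ℕ} [NeZero N] {W₀ : WeierstrassCurve ℚ} (D₀ : ModularParametrizationData W₀ N),
      D₀.abs_maninConstant_eq_one_of_isSemistable)
    (hMK : MazurKenkuBound) (h : ¬ CruxWithoutH) : ¬ ABC := fun habc =>
  h (Summit.ABC.ABC.Theorems.SharpDegreeOfPolyDegree.semistableDegreeConjecture_of_abc_of_facts
    hOpt hc1 hMK habc)

/-- **The binder `[IsGloballyMinimal]` of `H` is load-bearing for `H`** (landed by the B′ seat: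
rescalings `(1/m,0,0,0) • freyCurve 3 32` have fixed conductor and `|Δ| = m¹²|Δ₀|`). [folklore] -/
theorem not_polyHeightNonMinimal : ¬ PolyHeightNonMinimal :=
  Summit.ABC.ABC.Theorems.PolyHeightOfBoundedPrimes.Negative.not_polyHeight_without_isGloballyMinimal

/-- … hence moving minimality out of `H` makes the item VACUOUSLY true: the mutated crux carries no
content (planner note: the binder must stay inside the hypothesis). [folklore] -/
theorem cruxWithNonMinimalH_trivial : CruxWithNonMinimalH := fun h => absurd h not_polyHeightNonMinimal

/-- Semistability inside `H` is NOT load-bearing for plausibility: `H` over ALL globally minimal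
elliptic `W/ℚ` follows from the catalogued `GeneralizedSzpiroConjectureBG` (landed). [folklore] -/
theorem polyHeight_all_of_generalizedSzpiroBG (h : GeneralizedSzpiroConjectureBG) :
    ∃ σ C : ℝ, ∀ (W : WeierstrassCurve ℚ) [W.IsElliptic] [W.IsGloballyMinimal]
      [NeZero (W.conductorNorm ℤ)],
      ((max |W.Δ| (|W.c₄| ^ 3) : ℚ) : ℝ) ≤ C * (W.conductorNorm ℤ : ℝ) ^ σ :=
  Summit.ABC.ABC.Theorems.PolyHeightOfBoundedPrimes.Negative.polyHeight_without_isSemistable_of_generalizedSzpiroBG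
    h

/-- Non-vacuity of the binder class of `H` and `X`: semistable globally minimal curves with
arbitrarily large conductor exist (landed). -/
theorem binderClass_nonempty (N₀ : ℕ) :
    ∃ W : WeierstrassCurve ℚ, W.IsElliptic ∧ W.IsGloballyMinimal ∧ W.IsSemistable ℤ ∧
      N₀ < W.conductorNorm ℤ :=
  exists_semistable_globallyMinimal N₀

/-! ## §3 Degenerate parameters of the hypothesis -/

/-- Every slice `σ ≤ 6` of `H` is FALSE (Masser; landed p117587), so those slices of `R′` are vacuous. -/
theorem not_polyHeightAt_le_six {σ : ℝ} (hσ : σ ≤ 6) : ¬ PolyHeightAt σ := fun ⟨C, h⟩ =>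
  not_polyHeightAt_of_le_six hσ ⟨C, fun W _ _ _ hW => h W hW⟩

theorem cruxSlice_vacuous_of_le_six {σ : ℝ} (hσ : σ ≤ 6) :
    PolyHeightAt σ → SemistableDegreeConjecture := fun h => absurd h (not_polyHeightAt_le_six hσ)

/-- **NEW (landed `Negative/StrengthenedConsequent.lean` p120014 as `not_polyHeight_polylog`; proof kept
here verbatim until the farm snapshot carries the module): the polylog slice is false too.**
Masser's polylog excess `|Δ_min| > C N⁶ (log N)^k` (proved in the tree) on a global minimal model.
[cite: Masser1990, Theorem and Lemma 1] -/
theorem not_polyHeightPolylog : ¬ PolyHeightPolylog := by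
  rintro ⟨C, k, h⟩
  obtain ⟨W, hW, hss, hN, hlt⟩ :=
    Literature.Barriers.ABC.Masser.exists_semistable_curve_polylog_excess k C 0
  haveI := hW
  obtain ⟨W₁, hE₁, hM₁, hss₁, hN₁, hΔ₁⟩ := exists_globallyMinimal_model W
  haveI := hE₁
  haveI := hM₁
  haveI : NeZero (W₁.conductorNorm ℤ) := ⟨by rw [hN₁]; exact hN.ne'⟩
  have h1 := h W₁ (hss₁ hss)
  rw [hN₁] at h1
  have h2 : (W.minimalDiscriminantNorm ℤ : ℝ) ≤ ((max |W₁.Δ| (|W₁.c₄| ^ 3) : ℚ) : ℝ) := by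
    rw [← hΔ₁]
    exact Rat.cast_le.mpr (le_max_left _ _)
  exact absurd (h2.trans h1) (not_le.mpr hlt)

/-- WLOG for provers: any witness `(σ, C)` of `H` has `σ > 6` and `C > 0` (landed p117587). -/
theorem witness_window {σ C : ℝ}
    (h : ∀ (W : WeierstrassCurve ℚ) [W.IsElliptic] [W.IsGloballyMinimal]
      [NeZero (W.conductorNorm ℤ)], W.IsSemistable ℤ →
        ((max |W.Δ| (|W.c₄| ^ 3) : ℚ) : ℝ) ≤ C * (W.conductorNorm ℤ : ℝ) ^ σ) : 6 < σ ∧ 0 < C :=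
  ⟨six_lt_of_polyHeightAt h, pos_of_polyHeightAt h⟩

/-! ## §4 The consequent's floor: natural strengthenings of `R′` refuted -/

/-- Exponent `θ < 3/2` in the consequent is FALSE unconditionally (sibling p80513). -/
theorem not_targetWithExponent_lt_three_halves {θ : ℝ} (hθ : θ < 3 / 2) : ¬ TargetWithExponent θ :=
  not_targetWithExponent_of_lt_three_halves hθ

/-- Exponent `θ < 2` is FALSE modulo the route item `PeterssonLowerBound`. -/
theorem not_targetWithExponent_lt_two (hP : PeterssonLowerBound) {θ : ℝ} (hθ : θ < 2) :
    ¬ TargetWithExponent θ :=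
  not_targetWithExponent_of_lt_two hP hθ

/-- **Strengthened crux ⟺ `¬ H`** (`θ < 3/2` unconditionally). -/
theorem cruxWithExponent_iff_not_polyHeight_of_lt_three_halves {θ : ℝ} (hθ : θ < 3 / 2) :
    CruxWithExponent θ ↔ ¬ PolyHeight :=
  ⟨fun h hH => not_targetWithExponent_lt_three_halves hθ (h hH), fun h hH => absurd hH h⟩

/-- **Strengthened crux ⟺ `¬ H`** (`θ < 2`, mod `PeterssonLowerBound`). -/
theorem cruxWithExponent_iff_not_polyHeight_of_lt_two (hP : PeterssonLowerBound) {θ : ℝ}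
    (hθ : θ < 2) : CruxWithExponent θ ↔ ¬ PolyHeight :=
  ⟨fun h hH => not_targetWithExponent_lt_two hP hθ (h hH), fun h hH => absurd hH h⟩

/-- … so a proof of a strengthened `R′` is a disproof of the summit. -/
theorem not_abc_of_cruxWithExponent_of_lt_three_halves {θ : ℝ} (hθ : θ < 3 / 2)
    (h : CruxWithExponent θ) : ¬ ABC := fun habc =>
  (cruxWithExponent_iff_not_polyHeight_of_lt_three_halves hθ).mp h (polyHeight_of_abc habc)

/-- **NEW (landed `Negative/ConsequentFloor.lean` p120081 as `not_degreeBound_two_polylog_of_degCovol`;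
proof kept here verbatim until the farm snapshot carries the module): the `ε` of `X` cannot be dropped,
not even up to `(log N)^A`, modulo `DegCovolInput`.**  Watkins' Lemma 2.1 (`covol · |Δ_W|^{1/6} ≤ 14.045`,
PROVED) and Masser's curve with `|Δ_min| > (B N (log N)^{A+a+1})⁶`, `B = 14.045 (max C 0 + 1)/c`, on a
global minimal model give `log N < 1` against `N ≥ 3`. [cite: Masser1990, Theorem and Lemma 1] [cite: Watkins2004, Lemma 2.1] -/
theorem not_degreeBoundTwoPolylog_of_degCovol (hΩ : DegCovolInput) (A : ℝ) :
    ¬ DegreeBoundTwoPolylog A := by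
  rintro ⟨C, hdeg⟩
  obtain ⟨a, c, hc, N₀, hΩ⟩ := hΩ
  set C₁ : ℝ := max C 0 + 1 with hC₁
  have hC₁0 : 0 < C₁ := by rw [hC₁]; positivity
  have hCC₁ : C ≤ C₁ := by rw [hC₁]; linarith [le_max_left C 0]
  set B : ℝ := 14.045 * C₁ / c with hB
  have hB0 : 0 < B := by rw [hB]; positivity
  have hcB : C₁ * 14.045 = c * B := by rw [hB]; field_simp
  obtain ⟨W, hW, hss, hN, hlt⟩ :=
    Literature.Barriers.ABC.Masser.exists_semistable_curve_polylog_excess ((A + a + 1) * 6)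
      (B ^ 6) (max N₀ 3)
  haveI := hW
  obtain ⟨W₁, hE₁, hM₁, hss₁, hN₁, hΔ₁⟩ := exists_globallyMinimal_model W
  haveI := hE₁
  haveI := hM₁
  have hNpos : 0 < W₁.conductorNorm ℤ := by rw [hN₁]; omega
  haveI : NeZero (W₁.conductorNorm ℤ) := ⟨hNpos.ne'⟩
  have hN₀ : N₀ ≤ W₁.conductorNorm ℤ := by rw [hN₁]; omega
  have hN3' : 3 ≤ W₁.conductorNorm ℤ := by rw [hN₁]; omega
  obtain ⟨D, hD⟩ := hdeg W₁ (hss₁ hss)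
  have hΩD := hΩ W₁ (hss₁ hss) hN₀ D
  rw [← hN₁] at hlt
  set N : ℝ := (W₁.conductorNorm ℤ : ℝ) with hNdef
  set L : ℝ := Real.log N with hLdef
  set Ω : ℝ := ZLattice.covolume D.L.lattice with hΩdef
  set Δ : ℝ := ((|W₁.Δ| : ℚ) : ℝ) with hΔdef
  set d : ℝ := (D.modularDegree : ℝ) with hddef
  have hN3 : (3 : ℝ) ≤ N := by rw [hNdef]; exact_mod_cast hN3'
  have hN0 : 0 < N := by linarith
  have hL1 : 1 ≤ L := by
    rw [hLdef, Real.le_log_iff_exp_le hN0]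
    exact (Real.exp_one_lt_d9.le.trans (by norm_num)).trans hN3
  have hL0 : 0 < L := by linarith
  have hΩ0 : 0 < Ω := ZLattice.covolume_pos D.L.lattice _
  have h21 : Ω * Δ ^ (1 / 6 : ℝ) ≤ 14.045 := watkins2004_lemma_2_1_holds W₁ D.L D.isNeronLattice
  have hpow : (B * N * L ^ (A + a + 1)) ^ 6 = B ^ 6 * N ^ 6 * L ^ ((A + a + 1) * 6) := by
    rw [mul_pow, mul_pow, Real.rpow_mul hL0.le, show ((6 : ℝ)) = ((6 : ℕ) : ℝ) by norm_num,
      Real.rpow_natCast]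
  have hM : (B * N * L ^ (A + a + 1)) ^ 6 < Δ := by
    rw [hpow, hΔ₁]; exact hlt
  have hbase : 0 ≤ B * N * L ^ (A + a + 1) :=
    mul_nonneg (mul_nonneg hB0.le hN0.le) (Real.rpow_nonneg hL0.le _)
  have hroot : B * N * L ^ (A + a + 1) < Δ ^ (1 / 6 : ℝ) := by
    have h := Real.rpow_lt_rpow (pow_nonneg hbase 6) hM (by norm_num : (0 : ℝ) < 1 / 6)
    have h6 : ((B * N * L ^ (A + a + 1)) ^ 6) ^ (1 / 6 : ℝ) = B * N * L ^ (A + a + 1) := by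
      rw [one_div, show ((6 : ℝ))⁻¹ = ((6 : ℕ) : ℝ)⁻¹ by norm_num]
      exact Real.pow_rpow_inv_natCast hbase (by norm_num)
    rwa [h6] at h
  have h3 : Ω * (B * N * L ^ (A + a + 1)) < 14.045 :=
    lt_of_lt_of_le (mul_lt_mul_of_pos_left hroot hΩ0) h21
  have hLa : 0 < L ^ a := Real.rpow_pos_of_pos hL0 _
  have h1 : c * N ≤ d * Ω * L ^ a := by
    have := hΩD
    rw [div_le_iff₀ hLa] at this
    exact this
  have hLA : 0 ≤ L ^ A := Real.rpow_nonneg hL0.le _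
  have h2 : d ≤ C₁ * N ^ 2 * L ^ A :=
    hD.trans (mul_le_mul_of_nonneg_right (mul_le_mul_of_nonneg_right hCC₁ (sq_nonneg _)) hLA)
  have h4 : L ^ (A + a + 1) = L ^ A * L ^ a * L := by
    rw [Real.rpow_add hL0, Real.rpow_add hL0, Real.rpow_one]
  have key : c * N * B * L < c * N * B * 1 := by
    calc c * N * B * L ≤ d * Ω * L ^ a * B * L := by
          have := mul_le_mul_of_nonneg_right (mul_le_mul_of_nonneg_right h1 hB0.le) hL0.le
          linarith
      _ ≤ C₁ * N ^ 2 * L ^ A * Ω * L ^ a * B * L := by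
          have hfac : 0 ≤ Ω * L ^ a * B * L :=
            mul_nonneg (mul_nonneg (mul_nonneg hΩ0.le hLa.le) hB0.le) hL0.le
          have := mul_le_mul_of_nonneg_right h2 hfac
          nlinarith [this]
      _ = C₁ * N * (Ω * (B * N * L ^ (A + a + 1))) := by rw [h4]; ring
      _ < C₁ * N * 14.045 := mul_lt_mul_of_pos_left h3 (mul_pos hC₁0 hN0)
      _ = c * N * B * 1 := by
          rw [show C₁ * N * 14.045 = N * (C₁ * 14.045) by ring, hcB]; ring
  have hcNB : 0 < c * N * B := mul_pos (mul_pos hc hN0) hB0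
  have : L < 1 := lt_of_mul_lt_mul_left key hcNB.le
  linarith

/-- The endpoint proper: no `deg ≤ C N²` (mod `DegCovolInput`). -/
theorem not_degreeBoundAt_two_of_degCovol (hΩ : DegCovolInput) : ¬ DegreeBoundAt 2 := by
  rintro ⟨C, h⟩
  refine not_degreeBoundTwoPolylog_of_degCovol hΩ 0 ⟨C, fun W _ _ _ hss => ?_⟩
  obtain ⟨D, hD⟩ := h W hss
  exact ⟨D, by rwa [Real.rpow_zero, mul_one, ← Real.rpow_two]⟩

/-- `DegCovolInput` from a GHL-type Petersson lower bound `(f,f) ≥ c N/(log N)^a` (Zagier + `c² ≥ 1`,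
tree theorem `four_pi_sq_mul_peterssonProduct_re_le_deg_mul_covolume`). [cite: HoffsteinLockhart1994, Thm. 0.1 and Appendix] -/
theorem degCovolInput_of_peterssonLog
    (hP : ∃ a c : ℝ, 0 < c ∧ ∃ N₀ : ℕ, ∀ (W : WeierstrassCurve ℚ) [W.IsElliptic]
      [W.IsGloballyMinimal] [NeZero (W.conductorNorm ℤ)], W.IsSemistable ℤ →
        N₀ ≤ W.conductorNorm ℤ → ∀ D : ModularParametrizationData W (W.conductorNorm ℤ),
          c * (W.conductorNorm ℤ : ℝ) / Real.log (W.conductorNorm ℤ) ^ a ≤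
            (peterssonProduct (Gamma0 (W.conductorNorm ℤ)) 2 D.f D.f).re) : DegCovolInput := by
  obtain ⟨a, c, hc, N₀, h⟩ := hP
  refine ⟨a, 4 * Real.pi ^ 2 * c, by positivity, N₀, fun W _ _ _ hss hN D => ?_⟩
  have h3 := mul_le_mul_of_nonneg_left (h W hss hN D) (by positivity : (0 : ℝ) ≤ 4 * Real.pi ^ 2)
  calc 4 * Real.pi ^ 2 * c * (W.conductorNorm ℤ : ℝ) / Real.log (W.conductorNorm ℤ) ^ a
        = 4 * Real.pi ^ 2 * (c * (W.conductorNorm ℤ : ℝ) / Real.log (W.conductorNorm ℤ) ^ a) := by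
          ring
    _ ≤ _ := h3.trans (four_pi_sq_mul_peterssonProduct_re_le_deg_mul_covolume D)

/-- `DegCovolInput` from the vendored named fact `watkins2004_thm_5_1` (first inequality).
[cite: Watkins2004, Theorem 5.1] -/
theorem degCovolInput_of_watkins (h : watkins2004_thm_5_1) : DegCovolInput := by
  refine ⟨1, 0.033 / 2, by norm_num, 20000, fun W _ _ _ hss hN D => ?_⟩
  have h1 := (h W hss hN D).1
  have hΩ : 0 < ZLattice.covolume D.L.lattice := ZLattice.covolume_pos D.L.lattice _
  have hN' : (20000 : ℝ) ≤ (W.conductorNorm ℤ : ℝ) := by exact_mod_cast hN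
  have hlog : 0 < Real.log (W.conductorNorm ℤ : ℝ) := Real.log_pos (by linarith)
  rw [Real.rpow_one]
  have h2 := mul_le_mul_of_nonneg_right h1 hΩ.le
  refine le_trans (le_of_eq ?_) h2
  field_simp

/-- **The `ε = 0` strengthening of `R′` is `¬ H`** (mod `DegCovolInput`), hence refutes the summit. -/
theorem cruxEpsZero_iff_not_polyHeight_of_degCovol (hΩ : DegCovolInput) :
    CruxEpsZero ↔ ¬ PolyHeight :=
  ⟨fun h hH => not_degreeBoundAt_two_of_degCovol hΩ (h hH), fun h hH => absurd hH h⟩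

theorem not_abc_of_cruxEpsZero_of_degCovol (hΩ : DegCovolInput) (h : CruxEpsZero) : ¬ ABC :=
  fun habc => (cruxEpsZero_iff_not_polyHeight_of_degCovol hΩ).mp h (polyHeight_of_abc habc)

/-- Instance: modulo `watkins2004_thm_5_1`, "`H ⟹ deg φ ≤ C N²`" refutes `ABC`. -/
theorem not_abc_of_cruxEpsZero_of_watkins (hw : watkins2004_thm_5_1) (h : CruxEpsZero) : ¬ ABC :=
  not_abc_of_cruxEpsZero_of_degCovol (degCovolInput_of_watkins hw) h

/-- **Quantifier-order strengthening of `X` refuted** (mod `DegCovolInput`): no single `C` serves every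
`ε > 0` (minimal datum + `ε → 0⁺`, the sibling workfile's limit step). [folklore] -/
theorem not_target_uniformConst_of_degCovol (hΩ : DegCovolInput) :
    ¬ ∃ C : ℝ, ∀ ε : ℝ, 0 < ε → ∀ (W : WeierstrassCurve ℚ) [W.IsElliptic] [W.IsGloballyMinimal]
      [NeZero (W.conductorNorm ℤ)], W.IsSemistable ℤ →
        ∃ D : ModularParametrizationData W (W.conductorNorm ℤ),
          (D.modularDegree : ℝ) ≤ C * (W.conductorNorm ℤ : ℝ) ^ (2 + ε) := by
  rintro ⟨C, hC⟩
  refine not_degreeBoundAt_two_of_degCovol hΩ ⟨C, fun W _ _ _ hss => ?_⟩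
  have hne : ∃ m : ℕ, ∃ D : ModularParametrizationData W (W.conductorNorm ℤ),
      D.modularDegree = m := by
    obtain ⟨D, -⟩ := hC 1 one_pos W hss
    exact ⟨_, D, rfl⟩
  classical
  obtain ⟨D₀, hD₀⟩ := Nat.find_spec hne
  refine ⟨D₀, ?_⟩
  have hmin : ∀ D : ModularParametrizationData W (W.conductorNorm ℤ),
      D₀.modularDegree ≤ D.modularDegree := fun D => by
    rw [hD₀]
    exact Nat.find_min' hne ⟨D, rfl⟩
  have hN0 : (0 : ℝ) < (W.conductorNorm ℤ : ℝ) := by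
    exact_mod_cast NeZero.pos (W.conductorNorm ℤ)
  have hdeg : ∀ ε : ℝ, 0 < ε →
      (D₀.modularDegree : ℝ) ≤ C * (W.conductorNorm ℤ : ℝ) ^ (2 + ε) := by
    intro ε hε
    obtain ⟨D, hD⟩ := hC ε hε W hss
    exact le_trans (by exact_mod_cast hmin D) hD
  have ht : Tendsto (fun ε : ℝ => C * (W.conductorNorm ℤ : ℝ) ^ (2 + ε)) (𝓝[>] 0)
      (𝓝 (C * (W.conductorNorm ℤ : ℝ) ^ (2 + (0 : ℝ)))) := by
    apply Tendsto.const_mul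
    have h1 : Tendsto (fun ε : ℝ => 2 + ε) (𝓝[>] (0 : ℝ)) (𝓝 (2 + 0)) :=
      ((continuous_const_add (2 : ℝ)).tendsto 0).mono_left nhdsWithin_le_nhds
    exact (Real.continuousAt_const_rpow hN0.ne').tendsto.comp h1
  rw [add_zero] at ht
  refine ge_of_tendsto ht ?_
  filter_upwards [self_mem_nhdsWithin] with ε hε
  exact hdeg ε hε

/-- **Summary of the exponent picture for `R′` (unconditional reformulation).** The admissible
exponents of `H` form an upper set inside `(6, ∞)` (Masser; modulo nothing) missing even the polylog
endpoint; the admissible degree exponents form an upper set missing `(−∞, 3/2)` unconditionally,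
`(−∞, 2)` mod `PeterssonLowerBound` and the (polylog) endpoint `2` mod `DegCovolInput`; `X` says the
latter contains `(2, ∞)`; `R′` says: if the former is non-empty, the latter contains `(2, ∞)`.  No slack
at either end, no free instance (from `H_σ` the calibration p102896 only returns degree exponent
`≈ 1 + σ/6 > 2`). [folklore] -/
theorem crux_iff_upperSets :
    SharpDegreeOfPolyHeight ↔
      ((∃ σ : ℝ, 6 < σ ∧ PolyHeightAt σ) → ∀ θ : ℝ, 2 < θ → DegreeBoundAt θ) := by
  constructor
  · rintro h ⟨σ, -, hσ⟩ θ hθ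
    have hX := h (polyHeight_iff.mpr ⟨σ, hσ⟩)
    have := hX (θ - 2) (by linarith)
    rwa [show 2 + (θ - 2) = θ by ring] at this
  · rintro h hH ε hε
    obtain ⟨σ, hσ⟩ := polyHeight_iff.mp hH
    have h6 : 6 < σ := by
      by_contra hle
      exact not_polyHeightAt_le_six (not_lt.mp hle) hσ
    exact h ⟨σ, h6, hσ⟩ (2 + ε) (by linarith)

/-! ## §5 No formal amplification: the arithmetic of the height must enter -/

/-- **The pure SHAPE of `R′` is false.** For an arbitrary real "height" function of the conductor,
a polynomial bound does not imply the `6 + ε` bound (witness `N ↦ N⁷`); so no proof of `R′` can be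
formal in `H` — it must use what `max(|Δ|, |c₄|³)` is. [folklore] -/
theorem not_shape_amplification_height :
    ¬ ∀ F : ℕ → ℝ, (∃ σ C : ℝ, ∀ N : ℕ, 1 ≤ N → F N ≤ C * (N : ℝ) ^ σ) →
      ∀ ε : ℝ, 0 < ε → ∃ C : ℝ, ∀ N : ℕ, 1 ≤ N → F N ≤ C * (N : ℝ) ^ (6 + ε) := by
  intro h
  obtain ⟨C, hC⟩ := h (fun N => (N : ℝ) ^ (7 : ℝ)) ⟨7, 1, fun N _ => by rw [one_mul]⟩ (1 / 2)
    (by norm_num)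
  -- at `N` large, `N^7 ≤ C N^{6.5}` fails: take `N = ⌈(max C 1)²⌉₊ + 1`
  set M : ℕ := ⌈(max C 1) ^ 2⌉₊ + 1 with hM
  have hM1 : 1 ≤ M := by omega
  have hMC : (max C 1) ^ 2 < (M : ℝ) := by
    have := Nat.le_ceil ((max C 1) ^ 2)
    rw [hM]; push_cast; linarith
  have hC1 : 1 ≤ max C 1 := le_max_right _ _
  have hM0 : (0 : ℝ) < M := by exact_mod_cast hM1
  have h1 := hC M hM1
  -- `M^7 = M^{6.5} · M^{1/2}` and `M^{1/2} > max C 1 ≥ C`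
  have hsplit : (M : ℝ) ^ (7 : ℝ) = (M : ℝ) ^ (6 + 1 / 2 : ℝ) * (M : ℝ) ^ (1 / 2 : ℝ) := by
    rw [← Real.rpow_add hM0]; norm_num
  have hsqrt : max C 1 < (M : ℝ) ^ (1 / 2 : ℝ) := by
    have h2 : ((max C 1) ^ 2) ^ (1 / 2 : ℝ) < (M : ℝ) ^ (1 / 2 : ℝ) :=
      Real.rpow_lt_rpow (sq_nonneg _) hMC (by norm_num)
    have h6 : ((max C 1) ^ 2) ^ (1 / 2 : ℝ) = max C 1 := by
      rw [one_div, show ((2 : ℝ))⁻¹ = ((2 : ℕ) : ℝ)⁻¹ by norm_num]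
      exact Real.pow_rpow_inv_natCast (by linarith) (by norm_num)
    rwa [h6] at h2
  have hpos : 0 < (M : ℝ) ^ (6 + 1 / 2 : ℝ) := Real.rpow_pos_of_pos hM0 _
  have : C * (M : ℝ) ^ (6 + 1 / 2 : ℝ) < (M : ℝ) ^ (7 : ℝ) := by
    rw [hsplit, mul_comm]
    exact mul_lt_mul_of_pos_left (lt_of_le_of_lt (le_max_left C 1) hsqrt) hpos
  linarith

/-! ## §6 Near-misses (sorried on purpose; obstruction in the docstring) -/

/-- NEAR-MISS: the UNCONDITIONAL `ε = 0` floor of `X`.  Obstruction: needs `DegCovolInput`, i.e. a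
Petersson lower bound `(f,f) ≫ N/(log N)^a` (no Siegel zero for `L(s, Sym² f)`: Goldfeld–Hoffstein–
Lieman 1994), which the tree has only as the undischarged named fact `watkins2004_thm_5_1` (apex-size:
`Sym²`/`Sym⁴` `L`-functions, Bump–Ginzburg).  Tried: Iwaniec's PROVED `(f,f) ≫ N^{1/2−δ}` and the item
`PeterssonLowerBound` (`N^{1−ε}`) both lose a power of `N`, which Masser's sub-power excess cannot repay;
Silverman's covolume inequality loses `|Δ|^ε` but Watkins' L2.1 (proved) repairs that side exactly. -/
theorem not_degreeBoundAt_two_unconditional : ¬ DegreeBoundAt 2 := by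
  sorry

/-! ## §7 Targets (lead's stuck stubs): none this cycle — payload.targets = []; PICKED = `Sketch`
(ideator census, no `stub_*`); lead -0 ended `blocked-on: stmt-ABC-2044`. -/

end Summit.ABC.ABC.Cruxes.SharpDegreeOfPolyHeight.Disproof

end
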